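import Summits.RiemannHypothesis.RiemannHypothesis.Theorems.Splittings.LiIndexSets
import HarnessLib

/-!
# Splittings — Li index sets, part 4/5: recurrence FOR a given family (`RecurrentFor`), Bombieri–Lagarias along such a
# set, and SLOW families recur in every SYNDETIC set (`HasGapsLe`)

Cell rh-split, seat rh-split-li-neg g2 (brief sha16 f79c5f09d8bcb036), card `run/shared/lean/pub/rh-split/cards/SPLIT-li-neg.md` §8.
Parts 1–3 (`LiIndexSetsPrelims`, `LiIndexSetsRecurrence`, `LiIndexSets`) proved Bombieri–Lagarias along an index set that
is recurrent for EVERY finite unit family (`IsLiRecurrent`) and the dichotomy BP-6.  This part isolates **the exact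
amount of recurrence Bombieri–Lagarias' proof consumes**:

* `RecurrentFor ρ S` — for every finite set `B` of members OUTSIDE the closed unit disc (`1 < |(1 − 1/ρ_i)⁻¹|`, i.e.
  `Re ρ_i > 1/2`) and every `N`, some `n ∈ S`, `n ≥ N`, has `Re((w_i/|w_i|)ⁿ) ≥ 1/2` for all `i ∈ B`
  (`w_i = (1 − 1/ρ_i)⁻¹`); `IsLiRecurrent.recurrentFor` — `IsLiRecurrent S` is the case «for every family»;
* `exists_tsum_neg_of_recurrentFor` — Bombieri–Lagarias (2) ⇒ (1), contrapositive, along a set recurrent FOR the family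
  (their proof verbatim; the landed `exists_tsum_neg_on` of part 3 is the special case `IsLiRecurrent S` — this is the
  strict generalisation, re-proved here because tree files are append-only; the `+n` form is in part 5/5);
* `HasGapsLe S g` — `S` is SYNDETIC with gap bound `g` (every interval `[m, m+g]` meets `S`);
  `exists_forall_norm_pow_sub_one_lt` (simultaneous return on the torus), `exists_mem_forall_half_le_re_pow_of_gaps`
  (slow phases recur in every syndetic set), `recurrentFor_of_gaps` — **if every member outside the closed unit disc has
  `|ρ_i − 1| ≥ H > 0`, then every `S` with gaps `≤ g`, `5g ≤ H`, is recurrent for the family.**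

Part 5/5 (`LiIndexSetsSyndetic.lean`): zeta level, `RH ⟺ λ_n ≥ 0 for all odd n` (zeros to height 101).

References: [BombieriLagarias1999] Thm. 1; [Li1997].

Provenance: cell rh-split, seat rh-split-li-neg g2, scratch `HOME/rh-split-li-neg/LiIndexSets.lean` v2 (sha16
c74f7d64217f426c, 1294 lines, card addendum §8; proofs verbatim), Part F re-homed by rh-split-typer-1 g2 as parts 4/5
(`LiIndexSetsRecurrentFor`, reviewed lane: the notions `RecurrentFor`, `HasGapsLe`) and 5/5 (`LiIndexSetsSyndetic`, no
new definitions) of the `LiIndexSets*` package (parts 1–3 = p468824, p469481, p470136), (lead priority list 2026-08-26T22:06Z).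
Typer-1 g2 replay: farm rc 0, 0 warnings, 0 sorry, std axioms on `exists_tsum_neg_of_recurrentFor`, `recurrentFor_of_gaps`.

HONEST LABEL: «SPLITTING SEARCH over kernel-typed RH-EQUIVALENCES; a splitting A ∧ B ⟹ RH is CONDITIONAL
bookkeeping unless A and B are both proved; nothing here bears on the truth of RH.»
-/

set_option linter.dupNamespace false

noncomputable section

open Complex Filter Topology Set
open scoped ComplexConjugate Real

namespace Summit.RiemannHypothesis.RiemannHypothesis.Theorems.Splittings.LiIndexSets

open Literature.NumberTheory.LFunctions
open Literature.NumberTheory.LFunctions.BombieriLagarias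
open Summit.RiemannHypothesis.RiemannHypothesis.Theorems.Splittings

section BL

variable {ι : Type*} {ρ : ι → ℂ} {m : ι → ℕ}

/-- **Recurrence of `S` FOR a given family `ρ`** — the exact amount of recurrence Bombieri–Lagarias'
proof consumes: for every finite set `B` of members OUTSIDE the closed unit disc (`1 < |(1 − 1/ρ_i)⁻¹|`,
i.e. `Re ρ_i > 1/2`) and every `N`, some `n ∈ S`, `n ≥ N`, has `Re((w_i/|w_i|)ⁿ) ≥ 1/2` for all `i ∈ B`,
`w_i = (1 − 1/ρ_i)⁻¹`.  `IsLiRecurrent S` is the case "for every family"; at the zeta level the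
members outside the disc are the hypothetical off-line zeros, whose phases are SLOW (Part F). -/
@[folklore] def RecurrentFor (ρ : ι → ℂ) (S : Set ℕ) : Prop :=
  ∀ B : Finset ι, (∀ i ∈ B, 1 < ‖(1 - 1 / ρ i)⁻¹‖) → ∀ N : ℕ, ∃ n ∈ S, N ≤ n ∧
    ∀ i ∈ B, 1 / 2 ≤ (((1 - 1 / ρ i)⁻¹ / ((‖(1 - 1 / ρ i)⁻¹‖ : ℝ) : ℂ)) ^ n).re

/-- A set recurrent for every finite unit family is recurrent for any given family. -/
theorem IsLiRecurrent.recurrentFor {S : Set ℕ} (hS : IsLiRecurrent S) (ρ : ι → ℂ) :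
    RecurrentFor ρ S := by
  intro B hB N
  exact hS.finset B (fun i ↦ (1 - 1 / ρ i)⁻¹ / ((‖(1 - 1 / ρ i)⁻¹‖ : ℝ) : ℂ)) (fun i hi ↦ by
    have h0 : (0 : ℝ) < ‖(1 - 1 / ρ i)⁻¹‖ := by linarith [hB i hi]
    rw [norm_div, Complex.norm_real, Real.norm_of_nonneg h0.le, div_self h0.ne']) N

/-- **Bombieri–Lagarias (2) ⇒ (1) along an index set recurrent for the family, contrapositive.**  If some
`ρ_{i₀}` has `Re ρ_{i₀} > 1/2` and `S` is recurrent for `ρ`, some Bombieri–Lagarias sum with index `n ∈ S`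
is negative.  Bombieri–Lagarias' proof (tree `BombieriLagarias.exists_tsum_neg`) VERBATIM, the
simultaneous-recurrence step (their Dirichlet box) being the hypothesis, taken inside `S`.
[cite: BombieriLagarias1999, Theorem 1, proof] -/
theorem exists_tsum_neg_of_recurrentFor (hm : ∀ i, 0 < m i) (h1 : ∀ i, ρ i ≠ 1)
    (hR : Summable (weight ρ m)) {i₀ : ι} (hi₀ : 1 / 2 < (ρ i₀).re) {S : Set ℕ}
    (hS : RecurrentFor ρ S) :
    ∃ n ∈ S, 1 ≤ n ∧ ∑' i, (m i : ℝ) * (1 - (1 - 1 / ρ i)⁻¹ ^ n).re < 0 := by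
  classical
  set w : ι → ℂ := fun i ↦ (1 - 1 / ρ i)⁻¹ with hw
  set W : ι → ℝ := weight ρ m with hWdef
  set T : ℝ := ∑' i, W i with hTdef
  have hW0 : ∀ i, 0 ≤ W i := weight_nonneg ρ m
  have hT0 : 0 ≤ T := tsum_nonneg hW0
  -- Step 1: level sets `{μ ≤ |w_i|}`, `μ > 1`, are finite
  have hfinlev : ∀ μ : ℝ, 1 < μ → {i | μ ≤ ‖w i‖}.Finite := by
    intro μ hμ
    refine (finite_norm_le hm hR (max 1 (3 / (μ ^ 2 - 1)) + 1)).subset fun i hi ↦ ?_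
    have hb := norm_sub_one_le_of_le_norm hμ (h1 i) hi
    simp only [Set.mem_setOf_eq]
    calc ‖ρ i‖ = ‖(ρ i - 1) + 1‖ := by ring_nf
      _ ≤ ‖ρ i - 1‖ + ‖(1 : ℂ)‖ := norm_add_le _ _
      _ ≤ max 1 (3 / (μ ^ 2 - 1)) + 1 := by rw [norm_one]; linarith
  -- Step 2: the maximal modulus `λ`
  have hl1 : 1 < ‖w i₀‖ := (one_lt_norm_inv_one_sub_inv_iff (h1 i₀)).2 hi₀
  set A : Finset ι := (hfinlev _ hl1).toFinset with hA
  have hA₀ : i₀ ∈ A := by simp [hA]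
  have hAne : A.Nonempty := ⟨i₀, hA₀⟩
  set lam : ℝ := A.sup' hAne (fun i ↦ ‖w i‖) with hlam
  have hlamge : ‖w i₀‖ ≤ lam := Finset.le_sup' (fun i ↦ ‖w i‖) hA₀
  have hlam1 : 1 < lam := hl1.trans_le hlamge
  have hlam0 : 0 < lam := zero_lt_one.trans hlam1
  have hle_lam : ∀ i, ‖w i‖ ≤ lam := by
    intro i
    by_cases hi : i ∈ A
    · exact Finset.le_sup' (fun i ↦ ‖w i‖) hi
    · have : ¬ ‖w i₀‖ ≤ ‖w i‖ := by simpa [hA] using hi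
      exact (le_of_lt (not_le.1 this)).trans hlamge
  -- Step 3: the top set `B` (finite, nonempty) and its mass `MB ≥ 1`
  set B : Finset ι := (hfinlev lam hlam1).toFinset with hB
  have hmemB : ∀ i, i ∈ B ↔ ‖w i‖ = lam := by
    intro i
    simp only [hB, Set.Finite.mem_toFinset, Set.mem_setOf_eq]
    exact ⟨fun h ↦ le_antisymm (hle_lam i) h, fun h ↦ h.ge⟩
  obtain ⟨i₁, hi₁A, hi₁⟩ := Finset.exists_mem_eq_sup' hAne (fun i ↦ ‖w i‖)
  have hi₁B : i₁ ∈ B := (hmemB i₁).2 hi₁.symm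
  set MB : ℝ := ∑ i ∈ B, (m i : ℝ) with hMBdef
  have hMB1 : 1 ≤ MB := by
    calc (1 : ℝ) ≤ m i₁ := by exact_mod_cast hm i₁
      _ ≤ MB := Finset.single_le_sum (f := fun i ↦ (m i : ℝ)) (fun i _ ↦ Nat.cast_nonneg _) hi₁B
  -- Step 4: a uniform gap `|w_i| ≤ ν < λ` off `B`
  set μ : ℝ := (1 + lam) / 2 with hμ
  have hμ1 : 1 < μ := by rw [hμ]; linarith
  have hμlam : μ < lam := by rw [hμ]; linarith
  set A' : Finset ι := (hfinlev μ hμ1).toFinset with hA'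
  set s : Finset ι := A' \ B with hs
  set ν : ℝ := s.fold max μ (fun i ↦ ‖w i‖) with hν
  have hνlam : ν < lam := by
    rw [hν, Finset.fold_max_lt]
    refine ⟨hμlam, fun i hi ↦ lt_of_le_of_ne (hle_lam i) fun h ↦ ?_⟩
    exact (Finset.mem_sdiff.1 hi).2 ((hmemB i).2 h)
  have hμν : μ ≤ ν := by rw [hν, Finset.le_fold_max]; exact Or.inl le_rfl
  have hν0 : 0 ≤ ν := le_trans (by linarith) hμν
  have hoffB : ∀ i, i ∉ B → ‖w i‖ ≤ ν := by
    intro i hi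
    by_cases hi' : i ∈ A'
    · rw [hν, Finset.le_fold_max]
      exact Or.inr ⟨i, Finset.mem_sdiff.2 ⟨hi', hi⟩, le_rfl⟩
    · have : ¬ μ ≤ ‖w i‖ := by simpa [hA'] using hi'
      exact (le_of_lt (not_le.1 this)).trans hμν
  -- Step 5: for large `n` the main term wins: `(MB + 27 T n² + 9 T n² νⁿ)/λⁿ < MB/2`
  have hlim : Tendsto (fun n : ℕ ↦ MB * (1 / lam) ^ n + 27 * T * ((n : ℝ) ^ 2 * (1 / lam) ^ n)
      + 9 * T * ((n : ℝ) ^ 2 * (ν / lam) ^ n)) atTop (𝓝 0) := by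
    have hq1 : |1 / lam| < 1 := by
      rw [abs_of_pos (by positivity), div_lt_one hlam0]; exact hlam1
    have hq2 : |ν / lam| < 1 := by
      rw [abs_of_nonneg (by positivity), div_lt_one hlam0]; exact hνlam
    have t1 : Tendsto (fun n : ℕ ↦ (1 / lam) ^ n) atTop (𝓝 0) := by
      simpa using tendsto_pow_const_mul_const_pow_of_abs_lt_one 0 hq1
    have t2 := tendsto_pow_const_mul_const_pow_of_abs_lt_one 2 hq1
    have t3 := tendsto_pow_const_mul_const_pow_of_abs_lt_one 2 hq2
    have := (t1.const_mul MB).add ((t2.const_mul (27 * T)).add (t3.const_mul (9 * T)))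
    simpa [add_assoc] using this
  obtain ⟨N₀, hN₀⟩ := eventually_atTop.1
    (hlim.eventually_lt_const (show (0 : ℝ) < MB / 2 by linarith))
  -- Step 6: simultaneous recurrence on `B` with `z_i = w_i/λ`, the exponent taken INSIDE `S`
  obtain ⟨n, hnS, hnN, hcos0⟩ := hS B (fun i hi ↦ by
    show 1 < ‖w i‖
    rw [(hmemB i).1 hi]; exact hlam1) (max N₀ 1)
  have hcos : ∀ i ∈ B, 1 / 2 ≤ ((w i / (lam : ℂ)) ^ n).re := fun i hi ↦ by
    have h : 1 / 2 ≤ ((w i / ((‖w i‖ : ℝ) : ℂ)) ^ n).re := hcos0 i hi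
    rw [(hmemB i).1 hi] at h
    exact h
  have hn1 : 1 ≤ n := (le_max_right _ _).trans hnN
  have hnN₀ : N₀ ≤ n := (le_max_left _ _).trans hnN
  have hn1' : (1 : ℝ) ≤ n := by exact_mod_cast hn1
  have hnum : MB + 27 * T * (n : ℝ) ^ 2 + 9 * T * (n : ℝ) ^ 2 * ν ^ n < MB / 2 * lam ^ n := by
    have h := hN₀ n hnN₀
    have hlampow : 0 < lam ^ n := pow_pos hlam0 n
    have e : MB * (1 / lam) ^ n + 27 * T * ((n : ℝ) ^ 2 * (1 / lam) ^ n)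
        + 9 * T * ((n : ℝ) ^ 2 * (ν / lam) ^ n)
        = (MB + 27 * T * (n : ℝ) ^ 2 + 9 * T * (n : ℝ) ^ 2 * ν ^ n) / lam ^ n := by
      rw [div_pow, div_pow, one_pow]
      field_simp
    rw [e, div_lt_iff₀ hlampow] at h
    exact h
  refine ⟨n, hnS, hn1, ?_⟩
  -- Step 7: termwise majorant `g`
  set K : ℝ := 9 * (n : ℝ) ^ 2 * (1 + ν ^ n) + 18 * (n : ℝ) ^ 2 with hK
  have hνn : 0 ≤ ν ^ n := pow_nonneg hν0 n
  have hK0 : 0 ≤ K := by positivity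
  have hK18 : 18 * (n : ℝ) ^ 2 ≤ K := by
    rw [hK]; nlinarith [sq_nonneg (n : ℝ)]
  have hK9 : 9 * (n : ℝ) ^ 2 * (1 + ν ^ n) ≤ K := by
    rw [hK]; nlinarith [sq_nonneg (n : ℝ)]
  set f : ι → ℝ := fun i ↦ (m i : ℝ) * (1 - (1 - 1 / ρ i)⁻¹ ^ n).re with hf
  set g : ι → ℝ := fun i ↦ if i ∈ B then (m i : ℝ) * (1 - lam ^ n / 2) else K * W i with hg
  have hfg : ∀ i, f i ≤ g i := by
    intro i
    have hm0 : (0 : ℝ) ≤ m i := Nat.cast_nonneg _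
    by_cases hiB : i ∈ B
    · simp only [hf, hg, if_pos hiB]
      have hc := hcos i hiB
      have hpow : (w i) ^ n = ((lam ^ n : ℝ) : ℂ) * (w i / (lam : ℂ)) ^ n := by
        rw [Complex.ofReal_pow, ← mul_pow, mul_div_cancel₀ _ (Complex.ofReal_ne_zero.2 hlam0.ne')]
      have hre : ((1 - 1 / ρ i)⁻¹ ^ n).re = lam ^ n * ((w i / (lam : ℂ)) ^ n).re := by
        show (w i ^ n).re = _
        rw [hpow, Complex.re_ofReal_mul]
      rw [sub_re, one_re, hre]
      refine mul_le_mul_of_nonneg_left ?_ hm0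
      nlinarith [pow_pos hlam0 n]
    · simp only [hf, hg, if_neg hiB]
      by_cases hfar : (n : ℝ) ≤ ‖ρ i - 1‖
      · have ht := abs_re_term_le hn1 hfar
        calc (m i : ℝ) * (1 - (1 - 1 / ρ i)⁻¹ ^ n).re
            ≤ (m i : ℝ) * (18 * (n : ℝ) ^ 2 * ((1 + |(ρ i).re|) / (1 + ‖ρ i‖) ^ 2)) :=
              mul_le_mul_of_nonneg_left ((le_abs_self _).trans ht) hm0
          _ = 18 * (n : ℝ) ^ 2 * W i := by simp only [hWdef, weight]; ring
          _ ≤ K * W i := mul_le_mul_of_nonneg_right hK18 (hW0 i)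
      · have hnear : ‖ρ i - 1‖ < n := not_le.1 hfar
        have hρn : ‖ρ i‖ < n + 1 := by
          calc ‖ρ i‖ = ‖(ρ i - 1) + 1‖ := by ring_nf
            _ ≤ ‖ρ i - 1‖ + ‖(1 : ℂ)‖ := norm_add_le _ _
            _ < n + 1 := by rw [norm_one]; linarith
        have hone : (1 : ℝ) ≤ 9 * (n : ℝ) ^ 2 * ((1 + |(ρ i).re|) / (1 + ‖ρ i‖) ^ 2) := by
          rw [mul_div_assoc', one_le_div (by positivity)]
          have hρ0 : 0 ≤ ‖ρ i‖ := norm_nonneg _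
          calc (1 + ‖ρ i‖) ^ 2 ≤ (3 * (n : ℝ)) ^ 2 := by
                apply pow_le_pow_left₀ (by positivity)
                linarith
            _ = 9 * (n : ℝ) ^ 2 * 1 := by ring
            _ ≤ 9 * (n : ℝ) ^ 2 * (1 + |(ρ i).re|) := by
                gcongr; linarith [abs_nonneg (ρ i).re]
        have hterm : (1 - (1 - 1 / ρ i)⁻¹ ^ n).re ≤ 1 + ν ^ n := by
          refine (re_one_sub_pow_le _ n).trans ?_
          have : ‖(1 - 1 / ρ i)⁻¹‖ ≤ ν := hoffB i hiB
          gcongr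
        have h1ν : 0 ≤ 1 + ν ^ n := by positivity
        calc (m i : ℝ) * (1 - (1 - 1 / ρ i)⁻¹ ^ n).re ≤ (m i : ℝ) * (1 + ν ^ n) :=
              mul_le_mul_of_nonneg_left hterm hm0
          _ = (m i : ℝ) * (1 + ν ^ n) * 1 := (mul_one _).symm
          _ ≤ (m i : ℝ) * (1 + ν ^ n) *
                (9 * (n : ℝ) ^ 2 * ((1 + |(ρ i).re|) / (1 + ‖ρ i‖) ^ 2)) :=
              mul_le_mul_of_nonneg_left hone (mul_nonneg hm0 h1ν)
          _ = 9 * (n : ℝ) ^ 2 * (1 + ν ^ n) * W i := by simp only [hWdef, weight]; ring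
          _ ≤ K * W i := mul_le_mul_of_nonneg_right hK9 (hW0 i)
  -- Step 8: sum the majorant
  have hfs : Summable f := summable_term hm hR n
  set g₁ : ι → ℝ := fun i ↦ if i ∈ B then (m i : ℝ) * (1 - lam ^ n / 2) - K * W i else 0 with hg₁
  have hg₁s : Summable g₁ :=
    summable_of_ne_finset_zero (s := B) (fun i hi ↦ by simp only [hg₁, if_neg hi])
  have hg₂s : Summable (fun i ↦ K * W i) := hR.mul_left K
  have hgdec : g = fun i ↦ g₁ i + K * W i := by
    funext i
    simp only [hg, hg₁]
    split_ifs <;> ring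
  have hgs : Summable g := by rw [hgdec]; exact hg₁s.add hg₂s
  have hg₁sum : ∑' i, g₁ i ≤ MB * (1 - lam ^ n / 2) := by
    rw [tsum_eq_sum (s := B) (fun i hi ↦ by simp only [hg₁, if_neg hi]), hMBdef, Finset.sum_mul]
    refine Finset.sum_le_sum fun i hi ↦ ?_
    simp only [hg₁, if_pos hi]
    nlinarith [hW0 i, hK0]
  have hgsum : ∑' i, g i ≤ MB * (1 - lam ^ n / 2) + K * T := by
    rw [hgdec, hg₁s.tsum_add hg₂s, tsum_mul_left]
    exact add_le_add hg₁sum le_rfl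
  calc ∑' i, f i ≤ ∑' i, g i := hfs.tsum_le_tsum hfg hgs
    _ ≤ MB * (1 - lam ^ n / 2) + K * T := hgsum
    _ = MB + 27 * T * (n : ℝ) ^ 2 + 9 * T * (n : ℝ) ^ 2 * ν ^ n - MB / 2 * lam ^ n := by
        rw [hK]; ring
    _ < 0 := by linarith


/-! ## Slow families recur in every syndetic set -/

/-- `|zᵗ − 1| ≤ t |z − 1|` for a unit complex number. -/
theorem norm_pow_sub_one_le {z : ℂ} (hz : ‖z‖ = 1) (t : ℕ) : ‖z ^ t - 1‖ ≤ t * ‖z - 1‖ := by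
  induction t with
  | zero => simp
  | succ t ih =>
    calc ‖z ^ (t + 1) - 1‖ = ‖z * (z ^ t - 1) + (z - 1)‖ := by ring_nf
      _ ≤ ‖z * (z ^ t - 1)‖ + ‖z - 1‖ := norm_add_le _ _
      _ = ‖z ^ t - 1‖ + ‖z - 1‖ := by rw [norm_mul, hz, one_mul]
      _ ≤ t * ‖z - 1‖ + ‖z - 1‖ := by gcongr
      _ = ((t + 1 : ℕ) : ℝ) * ‖z - 1‖ := by push_cast; ring

/-- **Simultaneous return** (Bolzano–Weierstrass on the torus): for finitely many unit complex numbers,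
every `ε > 0` and every `N` there is `n ≥ N` with `|z_iⁿ − 1| < ε` for all `i`. -/
theorem exists_forall_norm_pow_sub_one_lt {κ : Type*} (B : Finset κ) (z : κ → ℂ)
    (hz : ∀ i ∈ B, ‖z i‖ = 1) {ε : ℝ} (hε : 0 < ε) (N : ℕ) :
    ∃ n : ℕ, N ≤ n ∧ ∀ i ∈ B, ‖z i ^ n - 1‖ < ε := by
  classical
  set xs : ℕ → (B → ℂ) := fun k i ↦ z i ^ k with hxs
  have hxmem : ∀ k, xs k ∈ Metric.closedBall (0 : B → ℂ) 1 := by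
    intro k
    rw [Metric.mem_closedBall, dist_zero_right, pi_norm_le_iff_of_nonneg zero_le_one]
    intro i
    simp only [hxs, norm_pow, hz i i.2, one_pow, le_refl]
  obtain ⟨a, -, φ, hφ, hlim⟩ := tendsto_subseq_of_bounded Metric.isBounded_closedBall hxmem
  obtain ⟨K, hK⟩ := Metric.tendsto_atTop.1 hlim (ε / 2) (by positivity)
  have hd : dist (xs (φ (K + N))) (xs (φ K)) < ε := by
    calc dist (xs (φ (K + N))) (xs (φ K))
        ≤ dist (xs (φ (K + N))) a + dist (xs (φ K)) a := dist_triangle_right _ _ _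
      _ < ε / 2 + ε / 2 := add_lt_add (hK _ (by omega)) (hK _ le_rfl)
      _ = ε := by ring
  have hmm' : φ K + N ≤ φ (K + N) := strictMono_add_le hφ K N
  refine ⟨φ (K + N) - φ K, by omega, fun i hi ↦ ?_⟩
  have hi' := (dist_pi_lt_iff hε).1 hd ⟨i, hi⟩
  rw [dist_eq_norm] at hi'
  simp only [hxs] at hi'
  have hfac : z i ^ φ (K + N) - z i ^ φ K = z i ^ φ K * (z i ^ (φ (K + N) - φ K) - 1) := by
    rw [mul_sub, mul_one, ← pow_add, Nat.add_sub_cancel' (by omega : φ K ≤ φ (K + N))]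
  rw [hfac, norm_mul, norm_pow, hz i hi, one_pow, one_mul] at hi'
  exact hi'

/-- `S` has **gaps ≤ g** (is syndetic with bound `g`): every interval `[m, m + g]` meets `S`. -/
@[folklore] def HasGapsLe (S : Set ℕ) (g : ℕ) : Prop := ∀ m : ℕ, ∃ n ∈ S, m ≤ n ∧ n ≤ m + g

/-- **Slow phases recur in every syndetic set.**  Unit complex numbers `z_i` within `δ` of `1`, a set `S`
with gaps `≤ g`, `g δ ≤ 2/5`: then `S` contains arbitrarily large `n` with `Re(z_iⁿ) ≥ 1/2` for all `i`
(return `ε = 1/10`-close to `1` at some `n₁ ≥ N`, then walk `≤ g` steps to land in `S`). -/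
theorem exists_mem_forall_half_le_re_pow_of_gaps {κ : Type*} (B : Finset κ) (z : κ → ℂ)
    (hz : ∀ i ∈ B, ‖z i‖ = 1) {δ : ℝ} (hδ : ∀ i ∈ B, ‖z i - 1‖ ≤ δ) {S : Set ℕ} {g : ℕ}
    (hS : HasGapsLe S g) (hg : (g : ℝ) * δ ≤ 2 / 5) (N : ℕ) :
    ∃ n ∈ S, N ≤ n ∧ ∀ i ∈ B, 1 / 2 ≤ (z i ^ n).re := by
  obtain ⟨n₁, hNn₁, hn₁⟩ :=
    exists_forall_norm_pow_sub_one_lt B z hz (by norm_num : (0 : ℝ) < 1 / 10) N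
  obtain ⟨n, hnS, hn₁n, hnle⟩ := hS n₁
  refine ⟨n, hnS, hNn₁.trans hn₁n, fun i hi ↦ ?_⟩
  obtain ⟨t, rfl⟩ : ∃ t, n = n₁ + t := ⟨n - n₁, by omega⟩
  have ht : (t : ℝ) ≤ g := by exact_mod_cast (show t ≤ g by omega)
  have hmul : (t : ℝ) * ‖z i - 1‖ ≤ g * δ :=
    mul_le_mul ht (hδ i hi) (norm_nonneg _) (Nat.cast_nonneg g)
  have h1 : ‖z i ^ (n₁ + t) - 1‖ ≤ 1 / 2 := by
    have e : z i ^ (n₁ + t) - 1 = z i ^ n₁ * (z i ^ t - 1) + (z i ^ n₁ - 1) := by rw [pow_add]; ring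
    rw [e]
    calc ‖z i ^ n₁ * (z i ^ t - 1) + (z i ^ n₁ - 1)‖
        ≤ ‖z i ^ n₁ * (z i ^ t - 1)‖ + ‖z i ^ n₁ - 1‖ := norm_add_le _ _
      _ = ‖z i ^ t - 1‖ + ‖z i ^ n₁ - 1‖ := by rw [norm_mul, norm_pow, hz i hi, one_pow, one_mul]
      _ ≤ t * ‖z i - 1‖ + 1 / 10 := add_le_add (norm_pow_sub_one_le (hz i hi) t) (hn₁ i hi).le
      _ ≤ g * δ + 1 / 10 := by linarith
      _ ≤ 1 / 2 := by linarith
  have hre : 1 - (z i ^ (n₁ + t)).re ≤ ‖z i ^ (n₁ + t) - 1‖ := by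
    have h := Complex.re_le_norm (1 - z i ^ (n₁ + t))
    rw [norm_sub_rev] at h
    simpa only [sub_re, one_re] using h
  linarith

/-- **Recurrence for a slow family from bounded gaps.**  If every member of the family outside the closed
unit disc has `|ρ_i − 1| ≥ H > 0`, then every `S` with gaps `≤ g`, `5g ≤ H`, is recurrent for the family:
for such members `w_i = 1 + (ρ_i − 1)⁻¹` is within `1/H` of `1`, so its phase is within `2/H`. -/
theorem recurrentFor_of_gaps (h0 : ∀ i, ρ i ≠ 0) (h1 : ∀ i, ρ i ≠ 1) {H : ℝ} (hHpos : 0 < H)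
    (hH : ∀ i, 1 < ‖(1 - 1 / ρ i)⁻¹‖ → H ≤ ‖ρ i - 1‖) {S : Set ℕ} {g : ℕ} (hS : HasGapsLe S g)
    (hg : 5 * (g : ℝ) ≤ H) : RecurrentFor ρ S := by
  intro B hB N
  set w : ι → ℂ := fun i ↦ (1 - 1 / ρ i)⁻¹ with hw
  have key : ∀ i ∈ B, ‖w i / ((‖w i‖ : ℝ) : ℂ) - 1‖ ≤ 2 * H⁻¹ := by
    intro i hi
    have hwi : 1 < ‖w i‖ := hB i hi
    have hw0 : 0 < ‖w i‖ := by linarith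
    have hρ1 : 0 < ‖ρ i - 1‖ := lt_of_lt_of_le hHpos (hH i hwi)
    have hwsub : ‖w i - 1‖ ≤ H⁻¹ := by
      have e : w i - 1 = (ρ i - 1)⁻¹ := by
        show (1 - 1 / ρ i)⁻¹ - 1 = (ρ i - 1)⁻¹
        rw [inv_one_sub_inv_eq_one_add (h0 i) (h1 i)]; ring
      rw [e, norm_inv]
      exact (inv_le_inv₀ hρ1 hHpos).2 (hH i hwi)
    have habs : |1 - ‖w i‖| ≤ ‖w i - 1‖ := by
      have h := abs_norm_sub_norm_le (1 : ℂ) (w i)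
      rwa [norm_one, norm_sub_rev] at h
    have hne : ((‖w i‖ : ℝ) : ℂ) ≠ 0 := Complex.ofReal_ne_zero.2 hw0.ne'
    have hz1 : w i / ((‖w i‖ : ℝ) : ℂ) - 1 = (w i - ((‖w i‖ : ℝ) : ℂ)) / ((‖w i‖ : ℝ) : ℂ) :=
      div_sub_one hne
    have hn1 : ‖(1 : ℂ) - ((‖w i‖ : ℝ) : ℂ)‖ = |1 - ‖w i‖| := by
      rw [← Complex.ofReal_one, ← Complex.ofReal_sub, Complex.norm_real, Real.norm_eq_abs]
    rw [hz1, norm_div, Complex.norm_real, Real.norm_of_nonneg hw0.le]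
    calc ‖w i - ((‖w i‖ : ℝ) : ℂ)‖ / ‖w i‖ ≤ ‖w i - ((‖w i‖ : ℝ) : ℂ)‖ :=
          div_le_self (norm_nonneg _) hwi.le
      _ = ‖(w i - 1) + ((1 : ℂ) - ((‖w i‖ : ℝ) : ℂ))‖ := by congr 1; ring
      _ ≤ ‖w i - 1‖ + ‖(1 : ℂ) - ((‖w i‖ : ℝ) : ℂ)‖ := norm_add_le _ _
      _ = ‖w i - 1‖ + |1 - ‖w i‖| := by rw [hn1]
      _ ≤ H⁻¹ + H⁻¹ := add_le_add hwsub (habs.trans hwsub)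
      _ = 2 * H⁻¹ := by ring
  have hg' : (g : ℝ) * (2 * H⁻¹) ≤ 2 / 5 := by
    rw [show (g : ℝ) * (2 * H⁻¹) = (2 * g) / H by rw [div_eq_mul_inv]; ring,
      div_le_div_iff₀ hHpos (by norm_num : (0 : ℝ) < 5)]
    linarith
  exact exists_mem_forall_half_le_re_pow_of_gaps B (fun i ↦ w i / ((‖w i‖ : ℝ) : ℂ))
    (fun i hi ↦ by
      have hw0 : (0 : ℝ) < ‖w i‖ := by linarith [hB i hi]
      rw [norm_div, Complex.norm_real, Real.norm_of_nonneg hw0.le, div_self hw0.ne'])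
    key hS hg' N

end BL

end Summit.RiemannHypothesis.RiemannHypothesis.Theorems.Splittings.LiIndexSets

end
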